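import Mathlib.NumberTheory.RamificationInertia.Valuation
import Mathlib.NumberTheory.NumberField.AdeleRing
import Mathlib.NumberTheory.NumberField.Completion.LiesOverInstances
import Mathlib.NumberTheory.NumberField.InfinitePlace.Ramification
import Mathlib.RingTheory.DedekindDomain.Ideal.Lemmas
import Mathlib.Topology.Algebra.UniformRing
import HarnessLib

/-!
# Base change of adeles along an extension of number fields: `𝔸_F → 𝔸_E`

Topic `NumberTheory/Automorphic` (infrastructure for base change, Arthur–Clozel Ch. 3: the
class-field character `η` of `E/F` "vanishing exactly on `F^* N(𝔸_E^*)`" and the norm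
`N : 𝔸_E^* → 𝔸^*` are phrased through the embedding `𝔸_F ⊆ 𝔸_E`); namespace `Literature.Automorphic`.
Everything **proved**; no named facts; Mathlib-only imports.

* **Local maps at finite places** (any extension `B/A` of Dedekind domains with fraction fields
  `L/K`): `adicCompletionOfLiesOver K L v w : K_v →+* L_w` for `w ∣ v`, the continuous extension
  of `K → L` (Mathlib `UniformSpace.Completion.mapRingHom` of the uniformly continuous
  `algebraMap : WithVal v → WithVal w`, Mathlib's
  `IsDedekindDomain.HeightOneSpectrum.uniformContinuous_algebraMap_liesOver`), extending `K → L`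
  (`_coe`), continuous, with **`v_w = v_v ^ e(w|v)` on `K_v`** (`valued_adicCompletionOfLiesOver`,
  from Mathlib's `valuation_liesOver` on `K` by density and local constancy of valuations), hence
  mapping `𝒪_v` into `𝒪_w`; `adicCompletionOfUnder A K L w : K_{w ∩ A} →+* L_w` is the case of the
  place below. (The same construction appears, for number fields and without the valuation
  formula, as `adicCompletionMap` in `EllipticCurves/ShaRestriction`; librarian: merge.)
* **Finite adeles**: `FiniteAdeleRing.baseChange A K L B : 𝔸_K^∞ →+* 𝔸_L^∞`,
  `(x_v)_v ↦ (x_{w ∩ A})_w` (Mathlib `RestrictedProduct.mapAlongRingHom` along `w ↦ w ∩ A`, which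
  has finite fibres, `HeightOneSpectrum.tendsto_under_cofinite`; integrality is preserved at every
  place), continuous, compatible with the diagonal embeddings (`baseChange_algebraMap`), injective
  (`w ↦ w ∩ A` is surjective, `HeightOneSpectrum.under_surjective`).
* **Number fields `E/F`**: `infiniteCompletionOfComap F E w : F_{w|F} →+* E_w` (Mathlib
  `NumberField.LiesOver.completionMap`), `InfiniteAdeleRing.baseChange F E : F_∞ →+* E_∞`, and
  **`AdeleRing.baseChange F E : 𝔸_F →+* 𝔸_E`** (componentwise on `F_∞ × 𝔸_F^∞`), continuous,
  injective, with `baseChange (a)_{𝔸_F} = (a)_{𝔸_E}` for `a ∈ F`; on units,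
  `AdeleRing.ideleBaseChange F E : 𝔸_Fˣ →* 𝔸_Eˣ` (injective).

This is the map `x ↦ x ⊗ 1` for `𝔸_E = 𝔸_F ⊗_F E` (Cassels–Fröhlich, Ch. II §14; the tensor
description itself is not needed and not proved here). `AdeleRing.baseChange` is a `def`, not an
`Algebra` instance: for `E = F` it is not definitionally the identity (Mathlib scopes its
completion instances `NumberField.LiesOver.*` for the same reason).

## References

* J. W. S. Cassels, A. Fröhlich (eds.), *Algebraic Number Theory* (1967), Ch. II (Cassels,
  *Global fields*), §10–§11 (`K_v ⊆ L_w`, `∑ [L_w : K_v] = [L : K]`), §14 (adeles).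
  [CasselsFrohlichANT1967]
* J. Arthur, L. Clozel, *Simple algebras, base change, and the advanced theory of the trace
  formula*, Ann. of Math. Stud. 120 (1989), Ch. 3, §3–§4 (`F^* N(𝔸_E^*) ⊆ 𝔸^*`).
  [ArthurClozelAMS120]
-/

noncomputable section

open IsDedekindDomain MonoidWithZeroHom MonoidWithZeroHom.ValueGroup₀ WithZero
open scoped RestrictedProduct

namespace Literature.NumberTheory.Automorphic

/-! ### Finite places: `K_v → L_w` for `w ∣ v` -/

section Local

variable {A : Type*} (K : Type*) (L : Type*) {B : Type*}
variable [CommRing A] [IsDedekindDomain A] [CommRing B] [IsDedekindDomain B] [Algebra A B]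
  [Module.IsTorsionFree A B]
variable [Field K] [Field L] [Algebra K L]
variable [Algebra A K] [IsFractionRing A K] [Algebra A L] [IsScalarTower A K L]
variable [Algebra B L] [IsFractionRing B L] [IsScalarTower A B L]

/-- **The local base-change map `K_v →+* L_w` for `w ∣ v`**: the continuous extension of
`K → L` to the completions (Mathlib `UniformSpace.Completion.mapRingHom` of the uniformly
continuous `algebraMap : WithVal v → WithVal w`,
`IsDedekindDomain.HeightOneSpectrum.uniformContinuous_algebraMap_liesOver`). Cassels–Fröhlich,
Ch. II §10–§11 (`K_v ⊆ L_w`). [folklore] -/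
def adicCompletionOfLiesOver (v : HeightOneSpectrum A) (w : HeightOneSpectrum B)
    [w.asIdeal.LiesOver v.asIdeal] : v.adicCompletion K →+* w.adicCompletion L :=
  (HeightOneSpectrum.adicCompletion.equiv L w).symm.toRingHom.comp
    ((UniformSpace.Completion.mapRingHom
        (algebraMap (WithVal (v.valuation K)) (WithVal (w.valuation L)))
        (HeightOneSpectrum.uniformContinuous_algebraMap_liesOver K L v w).continuous).comp
      (HeightOneSpectrum.adicCompletion.equiv K v).toRingHom)

/-- `K_v → L_w` extends `K → L`. [folklore] -/
@[simp] theorem adicCompletionOfLiesOver_coe (v : HeightOneSpectrum A) (w : HeightOneSpectrum B)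
    [w.asIdeal.LiesOver v.asIdeal] (x : K) :
    adicCompletionOfLiesOver K L v w (x : v.adicCompletion K) =
      ((algebraMap K L x : L) : w.adicCompletion L) := by
  apply HeightOneSpectrum.adicCompletion.ext
  simp only [adicCompletionOfLiesOver, RingHom.coe_comp, RingEquiv.toRingHom_eq_coe, RingHom.coe_coe,
    Function.comp_apply, HeightOneSpectrum.adicCompletion.equiv_apply]
  change (HeightOneSpectrum.adicCompletion.ofCompletion _).toCompletion = _
  rw [HeightOneSpectrum.adicCompletion.toCompletion_ofCompletion]
  change UniformSpace.Completion.mapRingHom _ _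
    ((WithVal.toVal (v.valuation K) x : WithVal (v.valuation K)) : (v.valuation K).Completion) =
    ((WithVal.toVal (w.valuation L) (algebraMap K L x) : WithVal (w.valuation L)) :
      (w.valuation L).Completion)
  rw [UniformSpace.Completion.mapRingHom_coe]
  rfl

/-- `K_v → L_w` is continuous. [folklore] -/
theorem continuous_adicCompletionOfLiesOver (v : HeightOneSpectrum A) (w : HeightOneSpectrum B)
    [w.asIdeal.LiesOver v.asIdeal] : Continuous (adicCompletionOfLiesOver K L v w) :=
  (HeightOneSpectrum.adicCompletion.continuous_ofCompletion L w).comp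
    (UniformSpace.Completion.continuous_map.comp
      (HeightOneSpectrum.adicCompletion.continuous_toCompletion K v))

/-- **Valuations under `K_v → L_w`**: `v_w(x) = v_v(x)^{e(w|v)}` on `K_v` (on `K` this is Mathlib's
`valuation_liesOver`; extended by density, the valuations being locally constant off `0`). [folklore] -/
theorem valued_adicCompletionOfLiesOver (v : HeightOneSpectrum A) (w : HeightOneSpectrum B)
    [w.asIdeal.LiesOver v.asIdeal] (y : v.adicCompletion K) :
    Valued.v (adicCompletionOfLiesOver K L v w y) = Valued.v y ^ v.asIdeal.ramificationIdx' w.asIdeal := by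
  set e := v.asIdeal.ramificationIdx' w.asIdeal
  rcases eq_or_ne y 0 with rfl | hy
  · rw [map_zero, map_zero, map_zero,
      zero_pow (Ideal.IsDedekindDomain.ramificationIdx'_ne_zero_of_liesOver w.asIdeal v.ne_bot)]
  · have hy' : adicCompletionOfLiesOver K L v w y ≠ 0 :=
      (map_ne_zero_iff _ (adicCompletionOfLiesOver K L v w).injective).mpr hy
    have h1 : {z : v.adicCompletion K | Valued.v z = Valued.v y} ∈ nhds y :=
      Valued.locally_const ((Valuation.ne_zero_iff _).mpr hy)
    have h2 : adicCompletionOfLiesOver K L v w ⁻¹'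
        {z : w.adicCompletion L | Valued.v z = Valued.v (adicCompletionOfLiesOver K L v w y)} ∈ nhds y :=
      (continuous_adicCompletionOfLiesOver K L v w).continuousAt.preimage_mem_nhds
        (Valued.locally_const ((Valuation.ne_zero_iff _).mpr hy'))
    obtain ⟨x, hx1, hx2⟩ :=
      (HeightOneSpectrum.denseRange_algebraMap (K := K) (v := v)).mem_nhds (Filter.inter_mem h1 h2)
    simp only [Set.mem_setOf_eq, Set.mem_preimage] at hx1 hx2
    rw [← hx2, ← hx1]
    change Valued.v (adicCompletionOfLiesOver K L v w (x : v.adicCompletion K)) =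
      Valued.v ((x : K) : v.adicCompletion K) ^ e
    rw [adicCompletionOfLiesOver_coe, HeightOneSpectrum.adicCompletion.valued_coe,
      HeightOneSpectrum.adicCompletion.valued_coe, HeightOneSpectrum.valuation_liesOver L v w]

/-- `K_v → L_w` maps `𝒪_v` into `𝒪_w`. [folklore] -/
theorem adicCompletionOfLiesOver_mem_adicCompletionIntegers (v : HeightOneSpectrum A)
    (w : HeightOneSpectrum B) [w.asIdeal.LiesOver v.asIdeal] {y : v.adicCompletion K}
    (hy : y ∈ v.adicCompletionIntegers K) :
    adicCompletionOfLiesOver K L v w y ∈ w.adicCompletionIntegers L := by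
  rw [HeightOneSpectrum.mem_adicCompletionIntegers] at hy ⊢
  rw [valued_adicCompletionOfLiesOver]
  exact pow_le_one' hy _

variable (A) in
/-- The place below: `K_{w ∩ A} →+* L_w` (`adicCompletionOfLiesOver` with the tautological
`LiesOver` instance of `HeightOneSpectrum.under`). [folklore] -/
def adicCompletionOfUnder [Algebra.IsIntegral A B] (w : HeightOneSpectrum B) :
    (w.under A).adicCompletion K →+* w.adicCompletion L :=
  @adicCompletionOfLiesOver A K L B _ _ _ _ _ _ _ _ _ _ _ _ _ _ _ _ (w.under A) w ⟨rfl⟩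

/-- `adicCompletionOfUnder` extends `K → L`. [folklore] -/
@[simp] theorem adicCompletionOfUnder_coe [Algebra.IsIntegral A B] (w : HeightOneSpectrum B) (x : K) :
    adicCompletionOfUnder A K L w (x : (w.under A).adicCompletion K) =
      ((algebraMap K L x : L) : w.adicCompletion L) :=
  @adicCompletionOfLiesOver_coe A K L B _ _ _ _ _ _ _ _ _ _ _ _ _ _ _ _ (w.under A) w ⟨rfl⟩ x

/-- `adicCompletionOfUnder` is continuous. [folklore] -/
theorem continuous_adicCompletionOfUnder [Algebra.IsIntegral A B] (w : HeightOneSpectrum B) :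
    Continuous (adicCompletionOfUnder A K L w) :=
  @continuous_adicCompletionOfLiesOver A K L B _ _ _ _ _ _ _ _ _ _ _ _ _ _ _ _ (w.under A) w ⟨rfl⟩

/-- `adicCompletionOfUnder` maps integers to integers. [folklore] -/
theorem adicCompletionOfUnder_mem_adicCompletionIntegers [Algebra.IsIntegral A B]
    (w : HeightOneSpectrum B) {y : (w.under A).adicCompletion K}
    (hy : y ∈ (w.under A).adicCompletionIntegers K) :
    adicCompletionOfUnder A K L w y ∈ w.adicCompletionIntegers L :=
  @adicCompletionOfLiesOver_mem_adicCompletionIntegers A K L B _ _ _ _ _ _ _ _ _ _ _ _ _ _ _ _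
    (w.under A) w ⟨rfl⟩ y hy

end Local

/-! ### Finite adeles: `𝔸_K^∞ → 𝔸_L^∞` -/

section FiniteAdele

variable (A : Type*) (K : Type*) (L : Type*) (B : Type*)
variable [CommRing A] [IsDedekindDomain A] [CommRing B] [IsDedekindDomain B] [Algebra A B]
  [Module.IsTorsionFree A B] [Algebra.IsIntegral A B]
variable [Field K] [Field L] [Algebra K L]
variable [Algebra A K] [IsFractionRing A K] [Algebra A L] [IsScalarTower A K L]
variable [Algebra B L] [IsFractionRing B L] [IsScalarTower A B L]

variable {B} in
/-- `w ↦ w ∩ A` has finite fibres (the primes over a given prime, Mathlib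
`IsDedekindDomain.primesOver_finite`), hence tends to the cofinite filter along the cofinite
filter. (Same statement as `Literature.NumberTheory.Automorphic.tendsto_under_cofinite` of `Sweep1Proofs`, repeated to keep
this file's imports elementary.) [folklore] -/
theorem HeightOneSpectrum.tendsto_under_cofinite :
    Filter.Tendsto (fun w : HeightOneSpectrum B => w.under A) Filter.cofinite Filter.cofinite := by
  refine Filter.Tendsto.cofinite_of_finite_preimage_singleton fun v => ?_
  have hfin : (HeightOneSpectrum.asIdeal ⁻¹' v.asIdeal.primesOver B :
      Set (HeightOneSpectrum B)).Finite :=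
    (IsDedekindDomain.primesOver_finite v.asIdeal B).preimage fun _ _ _ _ h =>
      HeightOneSpectrum.ext h
  refine Set.finite_coe_iff.mpr (hfin.subset fun w hw => ?_)
  have hw' : w.under A = v := hw
  exact ⟨w.isPrime, ⟨by rw [← hw']; rfl⟩⟩

/-- **Base change of finite adeles** `𝔸_K^∞ →+* 𝔸_L^∞`, `(x_v)_v ↦ (x_{w ∩ A})_w` viewed in `L_w`
through `K_{w ∩ A} → L_w` (Mathlib `RestrictedProduct.mapAlongRingHom` along `w ↦ w ∩ A`; integers
go to integers at every place). This is the map `𝔸_K → 𝔸_L = 𝔸_K ⊗_K L`, `x ↦ x ⊗ 1`, on finite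
parts (Cassels–Fröhlich, Ch. II §14). [folklore] -/
def FiniteAdeleRing.baseChange : FiniteAdeleRing A K →+* FiniteAdeleRing B L :=
  RestrictedProduct.mapAlongRingHom (fun v : HeightOneSpectrum A => v.adicCompletion K)
    (fun w : HeightOneSpectrum B => w.adicCompletion L) (fun w => w.under A)
    (HeightOneSpectrum.tendsto_under_cofinite A)
    (fun w : HeightOneSpectrum B => adicCompletionOfUnder A K L w)
    (Filter.Eventually.of_forall fun (w : HeightOneSpectrum B) _ hy =>
      adicCompletionOfUnder_mem_adicCompletionIntegers K L w hy)

/-- Components of the base change: `(x_L)_w = x_{w ∩ A}` in `L_w` (definitional). [folklore] -/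
@[simp] theorem FiniteAdeleRing.baseChange_apply (x : FiniteAdeleRing A K) (w : HeightOneSpectrum B) :
    FiniteAdeleRing.baseChange A K L B x w = adicCompletionOfUnder A K L w (x (w.under A)) := rfl

/-- The base change of finite adeles is continuous. [folklore] -/
theorem FiniteAdeleRing.continuous_baseChange : Continuous (FiniteAdeleRing.baseChange A K L B) :=
  RestrictedProduct.mapAlong_continuous (fun v : HeightOneSpectrum A => v.adicCompletion K)
    (fun w : HeightOneSpectrum B => w.adicCompletion L) (fun w => w.under A)
    (HeightOneSpectrum.tendsto_under_cofinite A)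
    (fun w : HeightOneSpectrum B => adicCompletionOfUnder A K L w)
    (Filter.Eventually.of_forall fun (w : HeightOneSpectrum B) _ hy =>
      adicCompletionOfUnder_mem_adicCompletionIntegers K L w hy)
    fun w => continuous_adicCompletionOfUnder K L w

/-- **Compatibility with the diagonal embeddings**: `(a)_{𝔸_K} ↦ (a)_{𝔸_L}` for `a ∈ K`. [folklore] -/
@[simp] theorem FiniteAdeleRing.baseChange_algebraMap (a : K) :
    FiniteAdeleRing.baseChange A K L B (algebraMap K (FiniteAdeleRing A K) a) =
      algebraMap L (FiniteAdeleRing B L) (algebraMap K L a) := by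
  refine FiniteAdeleRing.ext L fun w => ?_
  rw [FiniteAdeleRing.baseChange_apply, FiniteAdeleRing.algebraMap_apply,
    FiniteAdeleRing.algebraMap_apply, adicCompletionOfUnder_coe]

variable {A B} in
omit [Module.IsTorsionFree A B] in
/-- Every finite place of `K` lies below a finite place of `L` (`w ↦ w ∩ A` is surjective;
Mathlib `Ideal.exists_maximal_ideal_liesOver_of_isIntegral`). [folklore] -/
theorem HeightOneSpectrum.under_surjective [FaithfulSMul A B] :
    Function.Surjective (fun w : HeightOneSpectrum B => w.under A) := by
  intro v
  haveI := v.isMaximal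
  obtain ⟨Q, hQ, hQv⟩ := Ideal.exists_maximal_ideal_liesOver_of_isIntegral (S := B) v.asIdeal
  have hQ0 : Q ≠ ⊥ := fun h => by
    rw [h] at hQv
    exact v.ne_bot (by rw [hQv.over, Ideal.under_bot])
  exact ⟨⟨Q, hQ.isPrime, hQ0⟩, HeightOneSpectrum.ext hQv.over.symm⟩

/-- The base change of finite adeles is injective. [folklore] -/
theorem FiniteAdeleRing.baseChange_injective [FaithfulSMul A B] :
    Function.Injective (FiniteAdeleRing.baseChange A K L B) := by
  intro x y h
  refine FiniteAdeleRing.ext K fun v => ?_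
  obtain ⟨w, rfl⟩ := HeightOneSpectrum.under_surjective (A := A) (B := B) v
  have := congrArg (fun z : FiniteAdeleRing B L => z w) h
  simp only [FiniteAdeleRing.baseChange_apply] at this
  exact (adicCompletionOfUnder A K L w).injective this

end FiniteAdele

/-! ### Number fields: infinite places and the adele ring -/

section NumberField

open NumberField

variable (F E : Type*) [Field F] [Field E] [Algebra F E]

/-- **The local base-change map at infinite places** `F_v →+* E_w` for `v = w|_F`
(Mathlib `NumberField.LiesOver.completionMap` with the tautological `LiesOver` instance of
`InfinitePlace.comap`). [folklore] -/
def infiniteCompletionOfComap (w : InfinitePlace E) :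
    (w.comap (algebraMap F E)).Completion →+* w.Completion :=
  @NumberField.LiesOver.completionMap F E _ _ _ (w.comap (algebraMap F E)) w ⟨rfl⟩

/-- `F_v → E_w` extends `F → E`. [folklore] -/
@[simp] theorem infiniteCompletionOfComap_coe (w : InfinitePlace E) (x : F) :
    infiniteCompletionOfComap F E w (x : (w.comap (algebraMap F E)).Completion) =
      ((algebraMap F E x : E) : w.Completion) :=
  @NumberField.LiesOver.completionMap_coe F E _ _ _ (w.comap (algebraMap F E)) w ⟨rfl⟩ (WithAbs.toAbs _ x)

/-- `F_v → E_w` is continuous. [folklore] -/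
theorem continuous_infiniteCompletionOfComap (w : InfinitePlace E) :
    Continuous (infiniteCompletionOfComap F E w) :=
  @NumberField.LiesOver.continuous_completionMap F E _ _ _ (w.comap (algebraMap F E)) w ⟨rfl⟩

/-- **Base change of infinite adeles** `F_∞ →+* E_∞`, `(x_v)_v ↦ (x_{w|_F})_w`. [folklore] -/
def InfiniteAdeleRing.baseChange : InfiniteAdeleRing F →+* InfiniteAdeleRing E where
  toFun x w := infiniteCompletionOfComap F E w (x (w.comap (algebraMap F E)))
  map_one' := funext fun w => map_one (infiniteCompletionOfComap F E w)
  map_mul' x y := funext fun w => map_mul (infiniteCompletionOfComap F E w) (x _) (y _)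
  map_zero' := funext fun w => map_zero (infiniteCompletionOfComap F E w)
  map_add' x y := funext fun w => map_add (infiniteCompletionOfComap F E w) (x _) (y _)

/-- Components of the base change of infinite adeles (definitional). [folklore] -/
@[simp] theorem InfiniteAdeleRing.baseChange_apply (x : InfiniteAdeleRing F) (w : InfinitePlace E) :
    InfiniteAdeleRing.baseChange F E x w = infiniteCompletionOfComap F E w (x (w.comap (algebraMap F E))) :=
  rfl

/-- The base change of infinite adeles is continuous. [folklore] -/
theorem InfiniteAdeleRing.continuous_baseChange : Continuous (InfiniteAdeleRing.baseChange F E) :=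
  continuous_pi fun w => (continuous_infiniteCompletionOfComap F E w).comp (continuous_apply _)

/-- Compatibility with the diagonal embeddings at infinity. [folklore] -/
@[simp] theorem InfiniteAdeleRing.baseChange_algebraMap (a : F) :
    InfiniteAdeleRing.baseChange F E (algebraMap F (InfiniteAdeleRing F) a) =
      algebraMap E (InfiniteAdeleRing E) (algebraMap F E a) := by
  funext w
  rw [InfiniteAdeleRing.baseChange_apply, InfiniteAdeleRing.algebraMap_apply,
    InfiniteAdeleRing.algebraMap_apply, infiniteCompletionOfComap_coe]

/-- The base change of infinite adeles is injective. [folklore] -/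
theorem InfiniteAdeleRing.baseChange_injective [Algebra.IsAlgebraic F E] : Function.Injective (InfiniteAdeleRing.baseChange F E) := by
  intro x y h
  funext v
  obtain ⟨w, rfl⟩ := InfinitePlace.comap_surjective (k := F) (K := E) v
  have := congrFun h w
  simp only [InfiniteAdeleRing.baseChange_apply] at this
  exact (infiniteCompletionOfComap F E w).injective this

variable [NumberField F] [NumberField E]

/-- **Base change of adeles** `𝔸_F →+* 𝔸_E` (`x ↦ x ⊗ 1` under `𝔸_E = 𝔸_F ⊗_F E`), componentwise
on `F_∞ × 𝔸_F^∞`: at a place `w` of `E` the image of `x` is `x_v ∈ F_v ⊆ E_w`, `v = w|_F`.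
A `def`, not an `Algebra` instance (for `E = F` it is not definitionally the identity).
Cassels–Fröhlich, Ch. II §14; Arthur–Clozel write `N(𝔸_E^*) ⊆ 𝔸^*` through it.
[folklore] -/
def AdeleRing.baseChange : AdeleRing (𝓞 F) F →+* AdeleRing (𝓞 E) E :=
  (InfiniteAdeleRing.baseChange F E).prodMap (FiniteAdeleRing.baseChange (𝓞 F) F E (𝓞 E))

/-- The archimedean part of the base change (definitional). [folklore] -/
@[simp] theorem AdeleRing.baseChange_fst (x : AdeleRing (𝓞 F) F) :
    (AdeleRing.baseChange F E x).1 = InfiniteAdeleRing.baseChange F E x.1 := rfl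

/-- The finite part of the base change (definitional). [folklore] -/
@[simp] theorem AdeleRing.baseChange_snd (x : AdeleRing (𝓞 F) F) :
    (AdeleRing.baseChange F E x).2 = FiniteAdeleRing.baseChange (𝓞 F) F E (𝓞 E) x.2 := rfl

/-- The base change of adeles is continuous. [folklore] -/
theorem AdeleRing.continuous_baseChange : Continuous (AdeleRing.baseChange F E) :=
  ((InfiniteAdeleRing.continuous_baseChange F E).comp continuous_fst).prodMk
    ((FiniteAdeleRing.continuous_baseChange (𝓞 F) F E (𝓞 E)).comp continuous_snd)

/-- **Compatibility with the diagonal embeddings**: `(a)_{𝔸_F} ↦ (a)_{𝔸_E}` for `a ∈ F`. [folklore] -/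
@[simp] theorem AdeleRing.baseChange_algebraMap (a : F) :
    AdeleRing.baseChange F E (algebraMap F (AdeleRing (𝓞 F) F) a) =
      algebraMap E (AdeleRing (𝓞 E) E) (algebraMap F E a) :=
  Prod.ext (InfiniteAdeleRing.baseChange_algebraMap F E a)
    (FiniteAdeleRing.baseChange_algebraMap (𝓞 F) F E (𝓞 E) a)

/-- The base change of adeles is injective. [folklore] -/
theorem AdeleRing.baseChange_injective : Function.Injective (AdeleRing.baseChange F E) :=
  fun _ _ h => Prod.ext (InfiniteAdeleRing.baseChange_injective F E (congrArg Prod.fst h))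
    (FiniteAdeleRing.baseChange_injective (𝓞 F) F E (𝓞 E) (congrArg Prod.snd h))

/-- **Base change of ideles** `𝔸_Fˣ →* 𝔸_Eˣ`. [folklore] -/
def AdeleRing.ideleBaseChange : (AdeleRing (𝓞 F) F)ˣ →* (AdeleRing (𝓞 E) E)ˣ :=
  Units.map (AdeleRing.baseChange F E).toMonoidHom

/-- `ideleBaseChange x = baseChange x` on underlying adeles (definitional). [folklore] -/
@[simp] theorem AdeleRing.coe_ideleBaseChange (x : (AdeleRing (𝓞 F) F)ˣ) :
    ((AdeleRing.ideleBaseChange F E x : (AdeleRing (𝓞 E) E)ˣ) : AdeleRing (𝓞 E) E) =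
      AdeleRing.baseChange F E x := rfl

/-- The base change of ideles is injective. [folklore] -/
theorem AdeleRing.ideleBaseChange_injective : Function.Injective (AdeleRing.ideleBaseChange F E) :=
  fun _ _ h => Units.ext (AdeleRing.baseChange_injective F E
    (congrArg (fun u : (AdeleRing (𝓞 E) E)ˣ => (u : AdeleRing (𝓞 E) E)) h))

end NumberField


end Literature.NumberTheory.Automorphic
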